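import Summits.QuantumFields.QCD.Theses.CounterexampleMustBeHot
import Literature.MathematicalPhysics.QuantumFieldTheory.QCDThermalPartition

/-!
# Line `goldstone-gas` — skeleton for the piece `ColdHotWitness` (stmt-QuantumFields-18758) of the
# decomposition of `ChiralColdCertificate` (stmt-QuantumFields-17303), crux-strategist r1

`ColdHotWitness` (the ∃-piece): one regularisation that is COLD at one temperature `T₁(m)` for every
positive mass tuple and `θ`-HOT at every temperature near the chiral limit.

Stubs (the witness is one object, so the line is: an ∃-stub carrying COLD together with a SPECTRAL
light-pion certificate, and a universal thermodynamic lemma turning the certificate into heat):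
* `stub_coldWitnessWithLightPions` — ∃ reg: data clauses, COLD for every `m > 0`, and for every `T > 0`
  a positive tuple `m(T)` with a LIGHT PION BAND at scale `T` (`LightBand`: momentum-resolved two-point
  LOWER bounds `c e^{−2T a_k n_k}` for all physical momenta `≤ T`, on all tori `≥ L_k`, frequently in `k` —
  Goldstone's theorem made quantitative on the lattice: `m_π² ∝ m`, GMOR). COLD is carried whole here:
  its own cut (infinite-volume certificate + aspect-1 finite-size/degeneracy control) needs the
  transfer-matrix vocabulary the route requested (`qcdThermalPartition` landed; positivity = Lüscher, wanted).
* `stub_heatFromLightPions` — GOLDSTONE GAS (universal, open but standard physics): a light band at scale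
  `T` forces `θ`-heat at `T` for a universal `θ > 0` (free pion gas: `p/T⁴ ≥ 8e^{−2}/(2π)³`, `F ≥ 0.04`;
  Gerber–Leutwyler), by the Gibbs variational principle on dilute multi-pion trial states — the
  thermodynamics-from-particle-structure step.
-/

noncomputable section

namespace Summit.QuantumFields.QCD.Cruxes.ChiralColdCertificate.GoldstoneGas

open scoped Topology BigOperators
open Filter Literature.MathematicalPhysics.QuantumFieldTheory
/-! ### Vocabulary over the Literature definition `thermalFreeEnergyDensity` (definitionally the route's
inlined `let f`, checked by `Iff.rfl` below) -/

/-- the thermodynamic (`N_s → ∞` at fixed `N_t`, shifted index `N_s + 1`) and zero-temperature (`N_t → ∞`)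
limits of the thermal free energy per site along the scheme: the route's `Lim`. -/
def ThermoLim (Nf : ℕ) (sch : QCDScheme Nf) (φ : ℕ → ℕ → ℝ) (e₀ : ℕ → ℝ) : Prop :=
  (∀ (k Nt : ℕ) [NeZero Nt], Tendsto
      (fun Ns : ℕ => thermalFreeEnergyDensity Nf Nt (Ns + 1) (sch.β k) (fun fl => sch.mq fl k))
      atTop (𝓝 (φ k Nt))) ∧ ∀ k : ℕ, Tendsto (φ k) atTop (𝓝 (e₀ k))

/-- the thermal degree-of-freedom count `F_k(N_t) = (90/π²) N_t⁴ (e₀(k) − φ_k(N_t))` (route's `F`). -/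
def dof (φ : ℕ → ℕ → ℝ) (e₀ : ℕ → ℝ) (k Nt : ℕ) : ℝ :=
  90 / Real.pi ^ 2 * (Nt : ℝ) ^ 4 * (e₀ k - φ k Nt)

/-- its finite-volume twin `F^fin_k(N_t, N_s)` (route's `Ffin`). -/
def dofFin (Nf : ℕ) (sch : QCDScheme Nf) (e₀ : ℕ → ℝ) (k Nt Ns : ℕ) [NeZero Nt] [NeZero Ns] : ℝ :=
  90 / Real.pi ^ 2 * (Nt : ℝ) ^ 4 *
    (e₀ k - thermalFreeEnergyDensity Nf Nt Ns (sch.β k) (fun fl => sch.mq fl k))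

/-- the one-temperature, aspect-`≥ 1` cold certificate (route's `ColdFin`). -/
def ColdFinAt (Nf : ℕ) (sch : QCDScheme Nf) (e₀ : ℕ → ℝ) (η T₁ : ℝ) : Prop :=
  ∀ᶠ k in atTop, ∀ (Nt : ℕ) [NeZero Nt], Nt = ⌈(sch.a k * T₁)⁻¹⌉₊ →
    ∀ (Ns : ℕ) [NeZero Ns], Nt ≤ Ns → dofFin Nf sch e₀ k Nt Ns ≤ η


/-- COLD: the one-temperature certificate for every positive mass tuple, universal over the limit functions. -/
def ColdEverywhere (Nf : ℕ) (reg : QCDRegularisation Nf) : Prop :=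
  ∀ m : Fin Nf → ℝ, (∀ fl, 0 < m fl) → ∃ η : ℝ, η < 1 ∧ ∃ T₁ : ℝ, 0 < T₁ ∧
    ∀ (φ : ℕ → ℕ → ℝ) (e₀ : ℕ → ℝ), ThermoLim Nf (reg.scheme m 0 0) φ e₀ → ColdFinAt Nf (reg.scheme m 0 0) e₀ η T₁

/-- HOT near the chiral limit at level `θ`: at every temperature some positive tuple is `θ`-hot. -/
def HotNearChiral (Nf : ℕ) (reg : QCDRegularisation Nf) (θ : ℝ) : Prop :=
  ∀ T : ℝ, 0 < T → ∃ m : Fin Nf → ℝ, (∀ fl, 0 < m fl) ∧ ∀ (φ : ℕ → ℕ → ℝ) (e₀ : ℕ → ℝ),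
    ThermoLim Nf (reg.scheme m 0 0) φ e₀ → ∃ᶠ k in atTop, θ ≤ dof φ e₀ k ⌈((reg.scheme m 0 0).a k * T)⁻¹⌉₊

/-- The spatially Fourier-projected connected two-point function `Σ_x e^{2πi p·x/S'} ⟨A(0) B(n, x)⟩_conn`
of two gauge-invariant local lattice observables on the torus of side `S' = 2S + 1` (vocabulary of the
Statement: `qcdTorusExpect`, `QCDLatticeObservable.onTorus` with placement vector `(n, x)`). -/
def momentumCorr (Nf : ℕ) {R R' : ℕ} (β : ℝ) (S : ℕ) (mq : Fin Nf → ℝ) (A : QCDLatticeObservable Nf R)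
    (B : QCDLatticeObservable Nf R') (n : ℕ) (p : Fin 3 → ℤ) : ℂ :=
  ∑ x : Fin 3 → Fin (2 * S + 1),
    Complex.exp (2 * Real.pi * Complex.I * ((∑ i, (p i : ℝ) * ((x i : ℕ) : ℝ) : ℝ) : ℂ) / ((2 * S + 1 : ℕ) : ℂ)) *
      (qcdTorusExpect β (2 * S + 1) mq (fun U => A.onTorus (2 * S + 1) 0 U *
          B.onTorus (2 * S + 1) ![(n : ℤ), ((x 0 : ℕ) : ℤ), ((x 1 : ℕ) : ℤ), ((x 2 : ℕ) : ℤ)] U) -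
        qcdTorusExpect β (2 * S + 1) mq (A.onTorus (2 * S + 1) 0) *
          qcdTorusExpect β (2 * S + 1) mq (B.onTorus (2 * S + 1) ![(n : ℤ), ((x 0 : ℕ) : ℤ), ((x 1 : ℕ) : ℤ), ((x 2 : ℕ) : ℤ)]))

/-- LIGHT PION BAND at the scale `T` for the tuple `m`: a pair of local observables whose momentum-`p`
correlator at Euclidean time `n_k` (`a_k n_k → ∞`, `n_k ≤ L_k`) is bounded BELOW by `c e^{−2T a_k n_k}` for
every lattice momentum of physical size `≤ T` per component, on every torus `S ≥ L_k`, frequently in `k` —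
a band of states with energies `≤ 2T` above the vacuum filling the momentum ball of radius `T`
(the pseudo-Goldstone pions when `m_π(m) ≲ T`). -/
def LightBand (Nf : ℕ) (reg : QCDRegularisation Nf) (m : Fin Nf → ℝ) (T : ℝ) : Prop :=
  ∃ (R R' : ℕ) (A : QCDLatticeObservable Nf R) (B : QCDLatticeObservable Nf R') (c : ℝ), 0 < c ∧
    ∃ n : ℕ → ℕ, (∀ k, n k ≤ reg.L k) ∧ Tendsto (fun k => reg.a k * n k) atTop atTop ∧
      ∃ᶠ k in atTop, ∀ S : ℕ, reg.L k ≤ S → ∀ p : Fin 3 → ℤ,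
        (∀ i, 2 * Real.pi * |(p i : ℝ)| ≤ T * reg.a k * (2 * S + 1 : ℕ)) →
          c * Real.exp (-(2 * T * (reg.a k * n k))) ≤
            ‖momentumCorr Nf (reg.β k) S (fun fl => (reg.scheme m 0 0).mq fl k) A B (n k) p‖

/-- `ColdHotWitness` in this vocabulary. -/
def ColdHotWitnessLit : Prop :=
  ∀ Nf : ℕ, Nf = 2 ∨ Nf = 3 → ∃ reg : QCDRegularisation Nf, reg.HasMassScaling ∧
    (reg.scheme 0 0 0).HasAsymptoticScaling ∧ (∀ k : ℕ, 0 ≤ reg.β k) ∧ (∀ k : ℕ, -1 < reg.mcrit k) ∧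
    ColdEverywhere Nf reg ∧ ∃ θ : ℝ, 0 < θ ∧ HotNearChiral Nf reg θ

/-- STUB W1 — the cold witness with light pions (∃; open-problem: the certificate is the route's
single non-perturbative number, the band is lattice Goldstone/GMOR). -/
theorem stub_coldWitnessWithLightPions : ∀ Nf : ℕ, Nf = 2 ∨ Nf = 3 → ∃ reg : QCDRegularisation Nf, reg.HasMassScaling ∧
      (reg.scheme 0 0 0).HasAsymptoticScaling ∧ (∀ k : ℕ, 0 ≤ reg.β k) ∧ (∀ k : ℕ, -1 < reg.mcrit k) ∧
      ColdEverywhere Nf reg ∧ ∀ T : ℝ, 0 < T → ∃ m : Fin Nf → ℝ, (∀ fl, 0 < m fl) ∧ LightBand Nf reg m T := by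
  sorry

/-- STUB W2 — Goldstone gas: a light band at scale `T` is `θ`-hot at `T`, `θ` universal
(Gerber–Leutwyler 1989; Gibbs variational principle with dilute multi-pion trial states; L/open). -/
theorem stub_heatFromLightPions : ∀ Nf : ℕ, Nf = 2 ∨ Nf = 3 → ∃ θ : ℝ, 0 < θ ∧ ∀ (reg : QCDRegularisation Nf) (m : Fin Nf → ℝ) (T : ℝ),
      (∀ k : ℕ, 0 ≤ reg.β k) → (∀ fl, 0 < m fl) → 0 < T → LightBand Nf reg m T →
      ∀ (φ : ℕ → ℕ → ℝ) (e₀ : ℕ → ℝ), ThermoLim Nf (reg.scheme m 0 0) φ e₀ →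
        ∃ᶠ k in atTop, θ ≤ dof φ e₀ k ⌈((reg.scheme m 0 0).a k * T)⁻¹⌉₊ := by
  sorry

/-- Composition in this vocabulary. -/
theorem coldHotWitnessLit_of_stubs
    (h₁ : ∀ Nf : ℕ, Nf = 2 ∨ Nf = 3 → ∃ reg : QCDRegularisation Nf, reg.HasMassScaling ∧
      (reg.scheme 0 0 0).HasAsymptoticScaling ∧ (∀ k : ℕ, 0 ≤ reg.β k) ∧ (∀ k : ℕ, -1 < reg.mcrit k) ∧
      ColdEverywhere Nf reg ∧ ∀ T : ℝ, 0 < T → ∃ m : Fin Nf → ℝ, (∀ fl, 0 < m fl) ∧ LightBand Nf reg m T)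
    (h₂ : ∀ Nf : ℕ, Nf = 2 ∨ Nf = 3 → ∃ θ : ℝ, 0 < θ ∧ ∀ (reg : QCDRegularisation Nf) (m : Fin Nf → ℝ) (T : ℝ),
      (∀ k : ℕ, 0 ≤ reg.β k) → (∀ fl, 0 < m fl) → 0 < T → LightBand Nf reg m T →
      ∀ (φ : ℕ → ℕ → ℝ) (e₀ : ℕ → ℝ), ThermoLim Nf (reg.scheme m 0 0) φ e₀ →
        ∃ᶠ k in atTop, θ ≤ dof φ e₀ k ⌈((reg.scheme m 0 0).a k * T)⁻¹⌉₊) :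
    ColdHotWitnessLit := by
  intro Nf hNf
  obtain ⟨reg, hms, has, hβ, hcrit, hcold, hlight⟩ := h₁ Nf hNf
  obtain ⟨θ, hθ, hheat⟩ := h₂ Nf hNf
  refine ⟨reg, hms, has, hβ, hcrit, hcold, θ, hθ, fun T hT => ?_⟩
  obtain ⟨m, hm, hband⟩ := hlight T hT
  exact ⟨m, hm, fun φ e₀ hlim => hheat reg m T hβ hm hT hband φ e₀ hlim⟩

/-- The piece is definitionally its Literature-vocabulary form. -/
theorem coldHotWitness_iff_lit : Summit.QuantumFields.QCD.Theses.CounterexampleMustBeHot.ColdHotWitness ↔ ColdHotWitnessLit :=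
  Iff.rfl

/-- **Skeleton theorem — `ColdHotWitness` BY NAME from the registered stubs** (A12 shape: no hypotheses; the
only sorries of the file sit inside `stub_*`; once the stubs are proved this very theorem is the proof of
the piece). The sorry-free, kernel-checked composition with the stub statements as explicit hypotheses
is `coldHotWitnessLit_of_stubs` above (conclusion `ColdHotWitnessLit`,
definitionally the route decl: `coldHotWitness_iff_lit`). -/
theorem ColdHotWitness_of :
    Summit.QuantumFields.QCD.Theses.CounterexampleMustBeHot.ColdHotWitness :=
  coldHotWitness_iff_lit.mpr
    (coldHotWitnessLit_of_stubs stub_coldWitnessWithLightPions stub_heatFromLightPions)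

end Summit.QuantumFields.QCD.Cruxes.ChiralColdCertificate.GoldstoneGas

end
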